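import Literature.Barriers.CriticalPhenomena.WeaklySAWSeqSpaceCalculus
import HarnessLib

/-!
# Bounded linear plumbing on `ℓ^∞`: the zero-prepending shift, zipping of two sequence spaces, and
# evaluation at a scale

Auxiliary (folklore) file of the series formalising [BBS-rg-flow] (Bauerschmidt–Brydges–Slade, AHP 16
(2015), arXiv:1211.2477) towards `Literature.Barriers.CriticalPhenomena.WeaklySAWFourDimLogCorrections`,
for Theorem 1.4(ii) (smooth dependence of the critical flow on the initial condition): the flow map `T`
of `WeaklySAWFlowMap.lean` acts on `ℓ^∞(∏𝒲_j) × ℓ^∞(ℝ³)`, its `𝒦`-row reads the scale-`j` entry and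
writes the scale-`(j+1)` entry (`(T^K ỹ)₀ = 0`, `(T^K ỹ)_{j+1} = f_j(ỹ_j)`, cf. (3.8) of the source:
`(φ(x))₀ = 0`, `(φ(x))_{j+1} = φ_j(x_j)`). To differentiate `T` with the componentwise (Nemytskii)
calculus of `WeaklySAWSeqSpaceCalculus.lean` one needs three bounded linear maps, built here:
* `lpCons` — prepend a zero: `ℓ^∞(∏_j E_{j+1}) → ℓ^∞(∏_j E_j)`, `(u_j)_j ↦ (0, u_0, u_1, …)`, an isometry
  (`norm_lpCons`);
* `lpZip` — `ℓ^∞(∏E_j) × ℓ^∞(∏F_j) → ℓ^∞(∏(E_j × F_j))`, an isometry for the max norms (`norm_lpZip`);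
* `lpEval j` — evaluation `ℓ^∞(∏E_j) → E_j` at one scale, of norm `≤ 1`.

## References
* R. Bauerschmidt, D. C. Brydges, G. Slade, arXiv:1211.2477, §3.3, (3.8) (maps inserted into the
  sequence space with a shift). [BauerschmidtBrydgesSlade2015Flow]
-/

noncomputable section

open Set
open scoped ENNReal

namespace Literature.Barriers.CriticalPhenomena

namespace CTWSAW

section SeqSpaceShift

variable {E F : ℕ → Type*} [∀ j, NormedAddCommGroup (E j)] [∀ j, NormedAddCommGroup (F j)]

/-! ## Prepending a zero: the shift `(u_j)_j ↦ (0, u_0, u_1, …)` -/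

/-- The raw shifted family: `consFun u 0 = 0`, `consFun u (j+1) = u j`. [folklore] -/
def consFun (u : ∀ j, E (j + 1)) : ∀ j, E j
  | 0 => 0
  | j + 1 => u j

/-- `consFun u 0 = 0`. [folklore] -/
@[simp] theorem consFun_zero (u : ∀ j, E (j + 1)) : consFun u 0 = 0 := rfl

/-- `consFun u (j+1) = u j`. [folklore] -/
@[simp] theorem consFun_succ (u : ∀ j, E (j + 1)) (j : ℕ) : consFun u (j + 1) = u j := rfl

/-- `consFun` is additive. [folklore] -/
theorem consFun_add (u u' : ∀ j, E (j + 1)) : consFun (u + u') = consFun u + consFun u' := by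
  funext j; cases j <;> simp

/-- `consFun` is homogeneous. [folklore] -/
theorem consFun_smul (a : ℝ) [∀ j, NormedSpace ℝ (E j)] (u : ∀ j, E (j + 1)) :
    consFun (a • u) = a • consFun u := by
  funext j; cases j <;> simp

/-- The norms of the shifted family are those of the family (and `0`). [folklore] -/
theorem norm_consFun_le {u : ∀ j, E (j + 1)} {C : ℝ} (hC : 0 ≤ C) (hu : ∀ j, ‖u j‖ ≤ C) (j : ℕ) :
    ‖consFun u j‖ ≤ C := by
  cases j with
  | zero => simpa using hC
  | succ j => simpa using hu j

/-- A bounded family shifts to a bounded family. [folklore] -/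
theorem memℓp_consFun (u : lp (fun j => E (j + 1)) ∞) : Memℓp (consFun (u : ∀ j, E (j + 1))) ∞ :=
  memℓp_infty ⟨‖u‖, by
    rintro _ ⟨j, rfl⟩
    dsimp only
    exact norm_consFun_le (norm_nonneg _) (fun j => lp.norm_apply_le_norm ENNReal.top_ne_zero u j) j⟩

variable [∀ j, NormedSpace ℝ (E j)] [∀ j, NormedSpace ℝ (F j)]

/-- Prepending a zero as a linear map `ℓ^∞(∏_j E_{j+1}) → ℓ^∞(∏_j E_j)`. [folklore] -/
def lpConsLin : lp (fun j => E (j + 1)) ∞ →ₗ[ℝ] lp E ∞ where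
  toFun u := ⟨consFun (u : ∀ j, E (j + 1)), memℓp_consFun u⟩
  map_add' u u' := by ext j; cases j <;> simp
  map_smul' a u := by ext j; cases j <;> simp

/-- **Prepending a zero** `(u_j)_j ↦ (0, u_0, u_1, …)` as a bounded linear map
`ℓ^∞(∏_j E_{j+1}) → ℓ^∞(∏_j E_j)` (the insertion `(φ(x))₀ = 0`, `(φ(x))_{j+1} = φ_j(x_j)` of (3.8)).
[cite: BauerschmidtBrydgesSlade2015Flow, §3.3, (3.8)] -/
def lpCons : lp (fun j => E (j + 1)) ∞ →L[ℝ] lp E ∞ :=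
  (lpConsLin (E := E)).mkContinuous 1 fun u =>
    lp.norm_le_of_forall_le (by positivity) fun j => by
      rw [one_mul]
      exact norm_consFun_le (norm_nonneg _) (fun j => lp.norm_apply_le_norm ENNReal.top_ne_zero u j) j

/-- Unfolding of `lpCons` as a family. [folklore] -/
@[simp] theorem coe_lpCons (u : lp (fun j => E (j + 1)) ∞) :
    ((lpCons u : lp E ∞) : ∀ j, E j) = consFun (u : ∀ j, E (j + 1)) := rfl

/-- `(lpCons u) 0 = 0`. [folklore] -/
theorem lpCons_apply_zero (u : lp (fun j => E (j + 1)) ∞) : ((lpCons u : lp E ∞) : ∀ j, E j) 0 = 0 := rfl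

/-- `(lpCons u) (j+1) = u j`. [folklore] -/
theorem lpCons_apply_succ (u : lp (fun j => E (j + 1)) ∞) (j : ℕ) :
    ((lpCons u : lp E ∞) : ∀ j, E j) (j + 1) = u j := rfl

/-- `lpCons` is an isometry. [folklore] -/
theorem norm_lpCons (u : lp (fun j => E (j + 1)) ∞) : ‖(lpCons u : lp E ∞)‖ = ‖u‖ := by
  refine le_antisymm ?_ ?_
  · exact lp.norm_le_of_forall_le (norm_nonneg _) fun j =>
      norm_consFun_le (norm_nonneg _) (fun j => lp.norm_apply_le_norm ENNReal.top_ne_zero u j) j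
  · refine lp.norm_le_of_forall_le (norm_nonneg _) fun j => ?_
    have := lp.norm_apply_le_norm ENNReal.top_ne_zero (lpCons u : lp E ∞) (j + 1)
    simpa using this

/-- `‖lpCons‖ ≤ 1`. [folklore] -/
theorem norm_lpCons_le : ‖(lpCons : lp (fun j => E (j + 1)) ∞ →L[ℝ] lp E ∞)‖ ≤ 1 :=
  LinearMap.mkContinuous_norm_le _ zero_le_one _

/-! ## Zipping two sequence spaces: `ℓ^∞(∏E_j) × ℓ^∞(∏F_j) ≅ ℓ^∞(∏(E_j × F_j))` -/

omit [∀ j, NormedSpace ℝ (E j)] [∀ j, NormedSpace ℝ (F j)] in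
/-- A pair of bounded families zips to a bounded family. [folklore] -/
theorem memℓp_zip (y : lp E ∞ × lp F ∞) : Memℓp (fun j => ((y.1 : ∀ j, E j) j, (y.2 : ∀ j, F j) j)) ∞ :=
  memℓp_infty ⟨‖y‖, by
    rintro _ ⟨j, rfl⟩
    dsimp only
    rw [Prod.norm_def, Prod.norm_def]
    exact max_le_max (lp.norm_apply_le_norm ENNReal.top_ne_zero y.1 j)
      (lp.norm_apply_le_norm ENNReal.top_ne_zero y.2 j)⟩

/-- Zipping as a linear map. [folklore] -/
def lpZipLin : lp E ∞ × lp F ∞ →ₗ[ℝ] lp (fun j => E j × F j) ∞ where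
  toFun y := ⟨fun j => ((y.1 : ∀ j, E j) j, (y.2 : ∀ j, F j) j), memℓp_zip y⟩
  map_add' y y' := by ext j <;> simp
  map_smul' a y := by ext j <;> simp

/-- **Zipping** `((K_j)_j, (V_j)_j) ↦ ((K_j, V_j))_j` as a bounded linear map
`ℓ^∞(∏E_j) × ℓ^∞(∏F_j) → ℓ^∞(∏(E_j × F_j))` (the identification `X^𝗐 = ∏_j X_j`, `X_j = 𝒲_j ⊕ 𝒱` of (3.1)).
[cite: BauerschmidtBrydgesSlade2015Flow, §3.2, (3.1)] -/
def lpZip : lp E ∞ × lp F ∞ →L[ℝ] lp (fun j => E j × F j) ∞ :=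
  (lpZipLin (E := E) (F := F)).mkContinuous 1 fun y =>
    lp.norm_le_of_forall_le (by positivity) fun j => by
      rw [one_mul, Prod.norm_def, Prod.norm_def]
      exact max_le_max (lp.norm_apply_le_norm ENNReal.top_ne_zero y.1 j)
        (lp.norm_apply_le_norm ENNReal.top_ne_zero y.2 j)

/-- Unfolding of `lpZip` at a scale. [folklore] -/
@[simp] theorem lpZip_apply (y : lp E ∞ × lp F ∞) (j : ℕ) :
    ((lpZip y : lp (fun j => E j × F j) ∞) : ∀ j, E j × F j) j = ((y.1 : ∀ j, E j) j, (y.2 : ∀ j, F j) j) := rfl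

/-- `lpZip` is an isometry for the max norms. [folklore] -/
theorem norm_lpZip (y : lp E ∞ × lp F ∞) : ‖(lpZip y : lp (fun j => E j × F j) ∞)‖ = ‖y‖ := by
  refine le_antisymm ?_ ?_
  · refine lp.norm_le_of_forall_le (norm_nonneg _) fun j => ?_
    rw [lpZip_apply, Prod.norm_def, Prod.norm_def]
    exact max_le_max (lp.norm_apply_le_norm ENNReal.top_ne_zero y.1 j)
      (lp.norm_apply_le_norm ENNReal.top_ne_zero y.2 j)
  · have h1 : ‖y.1‖ ≤ ‖(lpZip y : lp (fun j => E j × F j) ∞)‖ :=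
      lp.norm_le_of_forall_le (norm_nonneg _) fun j =>
        (le_max_left _ _).trans
          ((Prod.norm_def _).symm.le.trans (lp.norm_apply_le_norm ENNReal.top_ne_zero (lpZip y) j))
    have h2 : ‖y.2‖ ≤ ‖(lpZip y : lp (fun j => E j × F j) ∞)‖ :=
      lp.norm_le_of_forall_le (norm_nonneg _) fun j =>
        (le_max_right _ _).trans
          ((Prod.norm_def _).symm.le.trans (lp.norm_apply_le_norm ENNReal.top_ne_zero (lpZip y) j))
    rw [Prod.norm_def]
    exact max_le h1 h2

/-- `‖lpZip‖ ≤ 1`. [folklore] -/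
theorem norm_lpZip_le : ‖(lpZip : lp E ∞ × lp F ∞ →L[ℝ] lp (fun j => E j × F j) ∞)‖ ≤ 1 :=
  LinearMap.mkContinuous_norm_le _ zero_le_one _

/-- Differences zip componentwise. [folklore] -/
theorem lpZip_sub_apply (y y' : lp E ∞ × lp F ∞) (j : ℕ) :
    ((lpZip y - lpZip y' : lp (fun j => E j × F j) ∞) : ∀ j, E j × F j) j =
      ((y.1 : ∀ j, E j) j - (y'.1 : ∀ j, E j) j, (y.2 : ∀ j, F j) j - (y'.2 : ∀ j, F j) j) := by
  rw [← map_sub]; rfl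

/-! ## Evaluation at one scale -/

/-- Evaluation at the scale `j` as a linear map. [folklore] -/
def lpEvalLin (j : ℕ) : lp E ∞ →ₗ[ℝ] E j where
  toFun f := (f : ∀ j, E j) j
  map_add' f g := by simp
  map_smul' a f := by simp

/-- **Evaluation at the scale `j`**, `ℓ^∞(∏E_j) → E_j`, a bounded linear map of norm `≤ 1`. [folklore] -/
def lpEval (j : ℕ) : lp E ∞ →L[ℝ] E j :=
  (lpEvalLin (E := E) j).mkContinuous 1 fun f => by
    rw [one_mul]; exact lp.norm_apply_le_norm ENNReal.top_ne_zero f j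

/-- Unfolding of `lpEval`. [folklore] -/
@[simp] theorem lpEval_apply (j : ℕ) (f : lp E ∞) : lpEval j f = (f : ∀ j, E j) j := rfl

/-- `‖lpEval j‖ ≤ 1`. [folklore] -/
theorem norm_lpEval_le (j : ℕ) : ‖(lpEval j : lp E ∞ →L[ℝ] E j)‖ ≤ 1 :=
  LinearMap.mkContinuous_norm_le _ zero_le_one _

/-- `‖f_j‖ ≤ ‖f‖`, restated through `lpEval`. [folklore] -/
theorem norm_lpEval_apply_le (j : ℕ) (f : lp E ∞) : ‖lpEval j f‖ ≤ ‖f‖ :=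
  lp.norm_apply_le_norm ENNReal.top_ne_zero f j

end SeqSpaceShift

end CTWSAW

end Literature.Barriers.CriticalPhenomena
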